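import Summits.CriticalPhenomena.PercolationContinuityZ3.Theorems.PercNearOneGluingNoHeavyLowerTailSahiSunflowerSun4CertDataA
import Summits.CriticalPhenomena.PercolationContinuityZ3.Theorems.PercNearOneGluingNoHeavyLowerTailSahiSunflowerTowerSymmetry
import Literature.Combinatorics.Sahi2008.SetPartitionForm
import Mathlib.Tactic.Linarith
import Mathlib.Tactic.Positivity
import Mathlib.Tactic.FinCases
import Mathlib.Tactic.NormNum
import HarnessLib

/-!
# `NoHeavyLowerTail` (crux stmt-CriticalPhenomena-4575), master-family line P2: `Sun 4` — cell expansions, the top row, `e₂ ≤ ab`, and kernel-replayed domination identities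

Support file (seat `prim-masterthm-p2`, gen 3; `--supports stmt-CriticalPhenomena-4575`); no named fact, no sorry.  Memo SAHI-ROUTE.md §4.12.
Part of the proof that on the sunflower poset `Sun 4` Sahi positivity of EVERY order is equivalent to the single top row `E_4(D_0,…,D_3) ≥ 0`:
by the structure theorem (`…SahiSunflowerTower`) only the CO-SINGLETON families need a proof, and each satisfies an exact DOMINATION
IDENTITY `∏_{i=n−1}^{m−2}(i + a)·E_n(F) = E_m(row) + P`, `P` with nonnegative coefficients modulo `a + b + Σc = 1` (found and verified by two
independent programs, certs/domination_m4.json); replayed here in the KERNEL through prim-cert-2's reflection engine `…FaceCertKernel`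
(`toPP/subCheckP/coeffsP`, `decide +kernel`) with the mass relation substituted symbolically (`SunCert.subst0`).
-/

namespace Summit.CriticalPhenomena.PercolationContinuityZ3.Theorems.SahiDeltaSystem
namespace Sun
open Lean.Grind.CommRing (Expr Context)
open Finset Function Literature.Combinatorics.Sahi2008

/-- `E(f)` on `Sun 4`, cell by cell. [this work] -/
theorem ex_eq4 (ν f : Sun 4 → ℝ) : ex ν f = ν core * f core + ν out * f out + ν (pet 0) * f (pet 0) + ν (pet 1) * f (pet 1) + ν (pet 2) * f (pet 2) + ν (pet 3) * f (pet 3) := by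
  rw [ex_def, sum_eq, Fin.sum_univ_four]
  ring

/-- Total mass one on `Sun 4`, written out. [this work] -/
theorem sum_one_eq4 {ν : Sun 4 → ℝ} (hν1 : ∑ x, ν x = 1) : ν core + ν out + ν (pet 0) + ν (pet 1) + ν (pet 2) + ν (pet 3) = 1 := by
  have h := hν1
  rw [sum_eq, Fin.sum_univ_four] at h
  linarith

/-- The top row of `Sun 4` as a vector literal. [this work] -/
theorem rowfam_eq4 : (fun i : Fin 4 => setInd (U (Finset.univ.erase i))) = ![setInd (U (Finset.univ.erase 0)), setInd (U (Finset.univ.erase 1)), setInd (U (Finset.univ.erase 2)), setInd (U (Finset.univ.erase 3))] := by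
  funext i; fin_cases i <;> rfl

set_option maxHeartbeats 2000000 in
set_option maxRecDepth 100000 in
/-- **`E_4` of the top row of `Sun 4` is the value of the reflected `eR4`** (expansion `sahiE_four`, each cell sum evaluated). [this work] -/
theorem row_eq4 (ν : Sun 4 → ℝ) : sahiE ν 4 (fun i => setInd (U (Finset.univ.erase i))) = eR4.denote (FaceCertKernel.ctx15 (ν core) (ν out) (ν (pet 0)) (ν (pet 1)) (ν (pet 2)) (ν (pet 3)) 0 0 0 0 0 0 0 0 0 : Context ℝ) := by
  rw [rowfam_eq4, sahiE_four]
  have r0 : ex ν (setInd (U (Finset.univ.erase 0)) * setInd (U (Finset.univ.erase 1)) * setInd (U (Finset.univ.erase 2)) * setInd (U (Finset.univ.erase 3))) = ν out := by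
    simp [ex_eq4, setInd_apply]
  have r1 : ex ν (setInd (U (Finset.univ.erase 0))) = ν out + ν (pet 1) + ν (pet 2) + ν (pet 3) := by
    simp [ex_eq4, setInd_apply]
  have r2 : ex ν (setInd (U (Finset.univ.erase 1)) * setInd (U (Finset.univ.erase 2)) * setInd (U (Finset.univ.erase 3))) = ν out + ν (pet 0) := by
    simp [ex_eq4, setInd_apply]
  have r3 : ex ν (setInd (U (Finset.univ.erase 1))) = ν out + ν (pet 0) + ν (pet 2) + ν (pet 3) := by
    simp [ex_eq4, setInd_apply]
  have r4 : ex ν (setInd (U (Finset.univ.erase 0)) * setInd (U (Finset.univ.erase 2)) * setInd (U (Finset.univ.erase 3))) = ν out + ν (pet 1) := by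
    simp [ex_eq4, setInd_apply]
  have r5 : ex ν (setInd (U (Finset.univ.erase 2))) = ν out + ν (pet 0) + ν (pet 1) + ν (pet 3) := by
    simp [ex_eq4, setInd_apply]
  have r6 : ex ν (setInd (U (Finset.univ.erase 0)) * setInd (U (Finset.univ.erase 1)) * setInd (U (Finset.univ.erase 3))) = ν out + ν (pet 2) := by
    simp [ex_eq4, setInd_apply]
  have r7 : ex ν (setInd (U (Finset.univ.erase 3))) = ν out + ν (pet 0) + ν (pet 1) + ν (pet 2) := by
    simp [ex_eq4, setInd_apply]
  have r8 : ex ν (setInd (U (Finset.univ.erase 0)) * setInd (U (Finset.univ.erase 1)) * setInd (U (Finset.univ.erase 2))) = ν out + ν (pet 3) := by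
    simp [ex_eq4, setInd_apply]
  have r9 : ex ν (setInd (U (Finset.univ.erase 2)) * setInd (U (Finset.univ.erase 3))) = ν out + ν (pet 0) + ν (pet 1) := by
    simp [ex_eq4, setInd_apply]
  have r10 : ex ν (setInd (U (Finset.univ.erase 1)) * setInd (U (Finset.univ.erase 3))) = ν out + ν (pet 0) + ν (pet 2) := by
    simp [ex_eq4, setInd_apply]
  have r11 : ex ν (setInd (U (Finset.univ.erase 1)) * setInd (U (Finset.univ.erase 2))) = ν out + ν (pet 0) + ν (pet 3) := by
    simp [ex_eq4, setInd_apply]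
  have r12 : ex ν (setInd (U (Finset.univ.erase 0)) * setInd (U (Finset.univ.erase 3))) = ν out + ν (pet 1) + ν (pet 2) := by
    simp [ex_eq4, setInd_apply]
  have r13 : ex ν (setInd (U (Finset.univ.erase 0)) * setInd (U (Finset.univ.erase 2))) = ν out + ν (pet 1) + ν (pet 3) := by
    simp [ex_eq4, setInd_apply]
  have r14 : ex ν (setInd (U (Finset.univ.erase 0)) * setInd (U (Finset.univ.erase 1))) = ν out + ν (pet 2) + ν (pet 3) := by
    simp [ex_eq4, setInd_apply]
  rw [r0, r1, r2, r3, r4, r5, r6, r7, r8, r9, r10, r11, r12, r13, r14]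
  rfl

set_option maxHeartbeats 2000000 in
set_option maxRecDepth 100000 in
/-- **The top row implies `e₂(c) ≤ ab`** on `Sun 4`: `(Σ_j c_j)² − Σ_j c_j² ≤ 2ab`, by the kernel-checked identity `(1 + a) * (2 + a)·(2ab − 2e₂) = 2·E_4(row) + P`
(cell masses abbreviated by the equations `ea, eb, e_j`; instantiate with `rfl`). [this work] -/
theorem e2_le_of_row4 {ν : Sun 4 → ℝ} (hν0 : ∀ x, 0 ≤ ν x) (hν1 : ∑ x, ν x = 1)
    (hrow : 0 ≤ sahiE ν 4 (fun i => setInd (U (Finset.univ.erase i))))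
    {a b c0 c1 c2 c3 : ℝ} (ea : ν core = a) (eb : ν out = b) (e0 : ν (pet 0) = c0) (e1 : ν (pet 1) = c1) (e2 : ν (pet 2) = c2) (e3 : ν (pet 3) = c3) :
    (∑ j, ν (pet j)) ^ 2 - ∑ j, ν (pet j) ^ 2 ≤ 2 * (ν core * ν out) := by
  have ha : 0 ≤ a := ea ▸ hν0 core
  have hb : 0 ≤ b := eb ▸ hν0 out
  have h0 : 0 ≤ c0 := e0 ▸ hν0 (pet 0)
  have h1 : 0 ≤ c1 := e1 ▸ hν0 (pet 1)
  have h2 : 0 ≤ c2 := e2 ▸ hν0 (pet 2)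
  have h3 : 0 ≤ c3 := e3 ▸ hν0 (pet 3)
  have hx := FaceCertKernel.ctx15_get_nonneg (R := ℝ) ha hb h0 h1 h2 h3 (le_refl (0:ℝ)) (le_refl (0:ℝ)) (le_refl (0:ℝ)) (le_refl (0:ℝ)) (le_refl (0:ℝ)) (le_refl (0:ℝ)) (le_refl (0:ℝ)) (le_refl (0:ℝ)) (le_refl (0:ℝ))
  have htot : a + b + c0 + c1 + c2 + c3 = 1 := by subst ea eb e0 e1 e2 e3; exact sum_one_eq4 hν1
  have hA : eA4.denote (FaceCertKernel.ctx15 a b c0 c1 c2 c3 0 0 0 0 0 0 0 0 0 : Context ℝ) = a := by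
    show (1:ℝ) - (b + c0 + c1 + c2 + c3) = a
    linarith
  have hchk : FaceCertKernel.subCheckP (FaceCertKernel.toPP (SunCert.subst0 eA4 (.mul eMulE4 (.sub (.mul (.num 2) (.mul (.var 0) (.var 1))) eSQ4))))
      (FaceCertKernel.toPP (SunCert.subst0 eA4 (.add (.mul (.num 2) eR4) ePE4))) = true := by
    decide +kernel
  have hid := FaceCertKernel.denote_eq_of_subCheckP (FaceCertKernel.ctx15 a b c0 c1 c2 c3 0 0 0 0 0 0 0 0 0 : Context ℝ) _ _ hchk
  rw [FaceCertKernel.denote_toPP _ _ (by decide +kernel), FaceCertKernel.denote_toPP _ _ (by decide +kernel),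
    SunCert.denote_subst0, SunCert.denote_subst0, hA] at hid
  have hid' : (1 + a) * (2 + a) * (2 * (a * b) - ((c0 + c1 + c2 + c3) ^ 2 - (c0 ^ 2 + c1 ^ 2 + c2 ^ 2 + c3 ^ 2))) = 2 * eR4.denote (FaceCertKernel.ctx15 a b c0 c1 c2 c3 0 0 0 0 0 0 0 0 0 : Context ℝ) + ePE4.denote (FaceCertKernel.ctx15 a b c0 c1 c2 c3 0 0 0 0 0 0 0 0 0 : Context ℝ) := hid
  have hP : 0 ≤ ePE4.denote (FaceCertKernel.ctx15 a b c0 c1 c2 c3 0 0 0 0 0 0 0 0 0 : Context ℝ) := by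
    rw [← FaceCertKernel.denote_toPP _ _ (by decide +kernel)]
    exact FaceCertKernel.denote_nonneg_of_coeffsP _ hx _ (by decide +kernel)
  have hM : (0:ℝ) < (1 + a) * (2 + a) := by positivity
  have hR : sahiE ν 4 (fun i => setInd (U (Finset.univ.erase i))) = eR4.denote (FaceCertKernel.ctx15 a b c0 c1 c2 c3 0 0 0 0 0 0 0 0 0 : Context ℝ) := by
    subst ea eb e0 e1 e2 e3; exact row_eq4 ν
  rw [hR] at hrow
  rw [Fin.sum_univ_four, Fin.sum_univ_four, ea, eb, e0, e1, e2, e3]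
  have h3 := (mul_nonneg_iff_of_pos_left hM).1 (by rw [hid']; exact add_nonneg (mul_nonneg (by norm_num) hrow) hP)
  linarith

set_option maxHeartbeats 2000000 in
set_option maxRecDepth 100000 in
/-- Co-singleton type 0 of `Sun 4` (index sets `[[0, 1], [0, 2], [1, 2]]`): `E_3 ≥ 0` from the top row, by the kernel-checked domination identity
`(2 + a)·E_3 = E_4(row) + P`, `P ≥ 0` (cell masses abbreviated by `ea, eb, e_j`; instantiate with `rfl`). [this work] -/
theorem co4_0 {ν : Sun 4 → ℝ} (hν0 : ∀ x, 0 ≤ ν x) (hν1 : ∑ x, ν x = 1)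
    (hrow : 0 ≤ sahiE ν 4 (fun i => setInd (U (Finset.univ.erase i))))
    {a b c0 c1 c2 c3 : ℝ} (ea : ν core = a) (eb : ν out = b) (e0 : ν (pet 0) = c0) (e1 : ν (pet 1) = c1) (e2 : ν (pet 2) = c2) (e3 : ν (pet 3) = c3) :
    0 ≤ sahiE ν 3 ![setInd (U {0, 1}), setInd (U {0, 2}), setInd (U {1, 2})] := by
  have ha : 0 ≤ a := ea ▸ hν0 core
  have hb : 0 ≤ b := eb ▸ hν0 out
  have h0 : 0 ≤ c0 := e0 ▸ hν0 (pet 0)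
  have h1 : 0 ≤ c1 := e1 ▸ hν0 (pet 1)
  have h2 : 0 ≤ c2 := e2 ▸ hν0 (pet 2)
  have h3 : 0 ≤ c3 := e3 ▸ hν0 (pet 3)
  have hx := FaceCertKernel.ctx15_get_nonneg (R := ℝ) ha hb h0 h1 h2 h3 (le_refl (0:ℝ)) (le_refl (0:ℝ)) (le_refl (0:ℝ)) (le_refl (0:ℝ)) (le_refl (0:ℝ)) (le_refl (0:ℝ)) (le_refl (0:ℝ)) (le_refl (0:ℝ)) (le_refl (0:ℝ))
  have htot : a + b + c0 + c1 + c2 + c3 = 1 := by subst ea eb e0 e1 e2 e3; exact sum_one_eq4 hν1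
  have hA : eA4.denote (FaceCertKernel.ctx15 a b c0 c1 c2 c3 0 0 0 0 0 0 0 0 0 : Context ℝ) = a := by
    show (1:ℝ) - (b + c0 + c1 + c2 + c3) = a
    linarith
  have hchk : FaceCertKernel.subCheckP (FaceCertKernel.toPP (SunCert.subst0 eA4 (.mul eMul4_3 eT4_0)))
      (FaceCertKernel.toPP (SunCert.subst0 eA4 (.add eR4 eP4_0))) = true := by
    decide +kernel
  have hid := FaceCertKernel.denote_eq_of_subCheckP (FaceCertKernel.ctx15 a b c0 c1 c2 c3 0 0 0 0 0 0 0 0 0 : Context ℝ) _ _ hchk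
  rw [FaceCertKernel.denote_toPP _ _ (by decide +kernel), FaceCertKernel.denote_toPP _ _ (by decide +kernel),
    SunCert.denote_subst0, SunCert.denote_subst0, hA, SunCert.denote_mul, SunCert.denote_add] at hid
  have hP : 0 ≤ eP4_0.denote (FaceCertKernel.ctx15 a b c0 c1 c2 c3 0 0 0 0 0 0 0 0 0 : Context ℝ) := by
    rw [← FaceCertKernel.denote_toPP _ _ (by decide +kernel)]
    exact FaceCertKernel.denote_nonneg_of_coeffsP _ hx _ (by decide +kernel)
  have hM : 0 < eMul4_3.denote (FaceCertKernel.ctx15 a b c0 c1 c2 c3 0 0 0 0 0 0 0 0 0 : Context ℝ) := by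
    show (0:ℝ) < (2 + a)
    positivity
  have hT : sahiE ν 3 ![setInd (U {0, 1}), setInd (U {0, 2}), setInd (U {1, 2})] = eT4_0.denote (FaceCertKernel.ctx15 a b c0 c1 c2 c3 0 0 0 0 0 0 0 0 0 : Context ℝ) := by
    subst ea eb e0 e1 e2 e3
    rw [sahiE_three]
    have x0 : ex ν (setInd (U {0, 1}) * setInd (U {0, 2}) * setInd (U {1, 2})) = ν out := by
      simp [ex_eq4, setInd_apply]
    have x1 : ex ν (setInd (U {0, 1})) = ν out + ν (pet 0) + ν (pet 1) := by
      simp [ex_eq4, setInd_apply]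
    have x2 : ex ν (setInd (U {0, 2})) = ν out + ν (pet 0) + ν (pet 2) := by
      simp [ex_eq4, setInd_apply]
    have x3 : ex ν (setInd (U {1, 2})) = ν out + ν (pet 1) + ν (pet 2) := by
      simp [ex_eq4, setInd_apply]
    have x4 : ex ν (setInd (U {0, 2}) * setInd (U {1, 2})) = ν out + ν (pet 2) := by
      simp [ex_eq4, setInd_apply]
    have x5 : ex ν (setInd (U {0, 1}) * setInd (U {1, 2})) = ν out + ν (pet 1) := by
      simp [ex_eq4, setInd_apply]
    have x6 : ex ν (setInd (U {0, 1}) * setInd (U {0, 2})) = ν out + ν (pet 0) := by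
      simp [ex_eq4, setInd_apply]
    rw [x0, x1, x2, x3, x4, x5, x6]
    rfl
  have hR : sahiE ν 4 (fun i => setInd (U (Finset.univ.erase i))) = eR4.denote (FaceCertKernel.ctx15 a b c0 c1 c2 c3 0 0 0 0 0 0 0 0 0 : Context ℝ) := by
    subst ea eb e0 e1 e2 e3; exact row_eq4 ν
  rw [hR] at hrow
  rw [hT]
  exact (mul_nonneg_iff_of_pos_left hM).1 (by rw [hid]; exact add_nonneg hrow hP)

set_option maxHeartbeats 2000000 in
set_option maxRecDepth 100000 in
/-- Co-singleton type 1 of `Sun 4` (index sets `[[0, 1], [0, 2], [1, 2, 3]]`): `E_3 ≥ 0` from the top row, by the kernel-checked domination identity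
`(2 + a)·E_3 = E_4(row) + P`, `P ≥ 0` (cell masses abbreviated by `ea, eb, e_j`; instantiate with `rfl`). [this work] -/
theorem co4_1 {ν : Sun 4 → ℝ} (hν0 : ∀ x, 0 ≤ ν x) (hν1 : ∑ x, ν x = 1)
    (hrow : 0 ≤ sahiE ν 4 (fun i => setInd (U (Finset.univ.erase i))))
    {a b c0 c1 c2 c3 : ℝ} (ea : ν core = a) (eb : ν out = b) (e0 : ν (pet 0) = c0) (e1 : ν (pet 1) = c1) (e2 : ν (pet 2) = c2) (e3 : ν (pet 3) = c3) :
    0 ≤ sahiE ν 3 ![setInd (U {0, 1}), setInd (U {0, 2}), setInd (U {1, 2, 3})] := by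
  have ha : 0 ≤ a := ea ▸ hν0 core
  have hb : 0 ≤ b := eb ▸ hν0 out
  have h0 : 0 ≤ c0 := e0 ▸ hν0 (pet 0)
  have h1 : 0 ≤ c1 := e1 ▸ hν0 (pet 1)
  have h2 : 0 ≤ c2 := e2 ▸ hν0 (pet 2)
  have h3 : 0 ≤ c3 := e3 ▸ hν0 (pet 3)
  have hx := FaceCertKernel.ctx15_get_nonneg (R := ℝ) ha hb h0 h1 h2 h3 (le_refl (0:ℝ)) (le_refl (0:ℝ)) (le_refl (0:ℝ)) (le_refl (0:ℝ)) (le_refl (0:ℝ)) (le_refl (0:ℝ)) (le_refl (0:ℝ)) (le_refl (0:ℝ)) (le_refl (0:ℝ))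
  have htot : a + b + c0 + c1 + c2 + c3 = 1 := by subst ea eb e0 e1 e2 e3; exact sum_one_eq4 hν1
  have hA : eA4.denote (FaceCertKernel.ctx15 a b c0 c1 c2 c3 0 0 0 0 0 0 0 0 0 : Context ℝ) = a := by
    show (1:ℝ) - (b + c0 + c1 + c2 + c3) = a
    linarith
  have hchk : FaceCertKernel.subCheckP (FaceCertKernel.toPP (SunCert.subst0 eA4 (.mul eMul4_3 eT4_1)))
      (FaceCertKernel.toPP (SunCert.subst0 eA4 (.add eR4 eP4_1))) = true := by
    decide +kernel
  have hid := FaceCertKernel.denote_eq_of_subCheckP (FaceCertKernel.ctx15 a b c0 c1 c2 c3 0 0 0 0 0 0 0 0 0 : Context ℝ) _ _ hchk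
  rw [FaceCertKernel.denote_toPP _ _ (by decide +kernel), FaceCertKernel.denote_toPP _ _ (by decide +kernel),
    SunCert.denote_subst0, SunCert.denote_subst0, hA, SunCert.denote_mul, SunCert.denote_add] at hid
  have hP : 0 ≤ eP4_1.denote (FaceCertKernel.ctx15 a b c0 c1 c2 c3 0 0 0 0 0 0 0 0 0 : Context ℝ) := by
    rw [← FaceCertKernel.denote_toPP _ _ (by decide +kernel)]
    exact FaceCertKernel.denote_nonneg_of_coeffsP _ hx _ (by decide +kernel)
  have hM : 0 < eMul4_3.denote (FaceCertKernel.ctx15 a b c0 c1 c2 c3 0 0 0 0 0 0 0 0 0 : Context ℝ) := by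
    show (0:ℝ) < (2 + a)
    positivity
  have hT : sahiE ν 3 ![setInd (U {0, 1}), setInd (U {0, 2}), setInd (U {1, 2, 3})] = eT4_1.denote (FaceCertKernel.ctx15 a b c0 c1 c2 c3 0 0 0 0 0 0 0 0 0 : Context ℝ) := by
    subst ea eb e0 e1 e2 e3
    rw [sahiE_three]
    have x0 : ex ν (setInd (U {0, 1}) * setInd (U {0, 2}) * setInd (U {1, 2, 3})) = ν out := by
      simp [ex_eq4, setInd_apply]
    have x1 : ex ν (setInd (U {0, 1})) = ν out + ν (pet 0) + ν (pet 1) := by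
      simp [ex_eq4, setInd_apply]
    have x2 : ex ν (setInd (U {0, 2})) = ν out + ν (pet 0) + ν (pet 2) := by
      simp [ex_eq4, setInd_apply]
    have x3 : ex ν (setInd (U {1, 2, 3})) = ν out + ν (pet 1) + ν (pet 2) + ν (pet 3) := by
      simp [ex_eq4, setInd_apply]
    have x4 : ex ν (setInd (U {0, 2}) * setInd (U {1, 2, 3})) = ν out + ν (pet 2) := by
      simp [ex_eq4, setInd_apply]
    have x5 : ex ν (setInd (U {0, 1}) * setInd (U {1, 2, 3})) = ν out + ν (pet 1) := by
      simp [ex_eq4, setInd_apply]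
    have x6 : ex ν (setInd (U {0, 1}) * setInd (U {0, 2})) = ν out + ν (pet 0) := by
      simp [ex_eq4, setInd_apply]
    rw [x0, x1, x2, x3, x4, x5, x6]
    rfl
  have hR : sahiE ν 4 (fun i => setInd (U (Finset.univ.erase i))) = eR4.denote (FaceCertKernel.ctx15 a b c0 c1 c2 c3 0 0 0 0 0 0 0 0 0 : Context ℝ) := by
    subst ea eb e0 e1 e2 e3; exact row_eq4 ν
  rw [hR] at hrow
  rw [hT]
  exact (mul_nonneg_iff_of_pos_left hM).1 (by rw [hid]; exact add_nonneg hrow hP)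

set_option maxHeartbeats 2000000 in
set_option maxRecDepth 100000 in
/-- Co-singleton type 2 of `Sun 4` (index sets `[[0, 1], [0, 2, 3], [1, 2, 3]]`): `E_3 ≥ 0` from the top row, by the kernel-checked domination identity
`(2 + a)·E_3 = E_4(row) + P`, `P ≥ 0` (cell masses abbreviated by `ea, eb, e_j`; instantiate with `rfl`). [this work] -/
theorem co4_2 {ν : Sun 4 → ℝ} (hν0 : ∀ x, 0 ≤ ν x) (hν1 : ∑ x, ν x = 1)
    (hrow : 0 ≤ sahiE ν 4 (fun i => setInd (U (Finset.univ.erase i))))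
    {a b c0 c1 c2 c3 : ℝ} (ea : ν core = a) (eb : ν out = b) (e0 : ν (pet 0) = c0) (e1 : ν (pet 1) = c1) (e2 : ν (pet 2) = c2) (e3 : ν (pet 3) = c3) :
    0 ≤ sahiE ν 3 ![setInd (U {0, 1}), setInd (U {0, 2, 3}), setInd (U {1, 2, 3})] := by
  have ha : 0 ≤ a := ea ▸ hν0 core
  have hb : 0 ≤ b := eb ▸ hν0 out
  have h0 : 0 ≤ c0 := e0 ▸ hν0 (pet 0)
  have h1 : 0 ≤ c1 := e1 ▸ hν0 (pet 1)
  have h2 : 0 ≤ c2 := e2 ▸ hν0 (pet 2)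
  have h3 : 0 ≤ c3 := e3 ▸ hν0 (pet 3)
  have hx := FaceCertKernel.ctx15_get_nonneg (R := ℝ) ha hb h0 h1 h2 h3 (le_refl (0:ℝ)) (le_refl (0:ℝ)) (le_refl (0:ℝ)) (le_refl (0:ℝ)) (le_refl (0:ℝ)) (le_refl (0:ℝ)) (le_refl (0:ℝ)) (le_refl (0:ℝ)) (le_refl (0:ℝ))
  have htot : a + b + c0 + c1 + c2 + c3 = 1 := by subst ea eb e0 e1 e2 e3; exact sum_one_eq4 hν1
  have hA : eA4.denote (FaceCertKernel.ctx15 a b c0 c1 c2 c3 0 0 0 0 0 0 0 0 0 : Context ℝ) = a := by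
    show (1:ℝ) - (b + c0 + c1 + c2 + c3) = a
    linarith
  have hchk : FaceCertKernel.subCheckP (FaceCertKernel.toPP (SunCert.subst0 eA4 (.mul eMul4_3 eT4_2)))
      (FaceCertKernel.toPP (SunCert.subst0 eA4 (.add eR4 eP4_2))) = true := by
    decide +kernel
  have hid := FaceCertKernel.denote_eq_of_subCheckP (FaceCertKernel.ctx15 a b c0 c1 c2 c3 0 0 0 0 0 0 0 0 0 : Context ℝ) _ _ hchk
  rw [FaceCertKernel.denote_toPP _ _ (by decide +kernel), FaceCertKernel.denote_toPP _ _ (by decide +kernel),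
    SunCert.denote_subst0, SunCert.denote_subst0, hA, SunCert.denote_mul, SunCert.denote_add] at hid
  have hP : 0 ≤ eP4_2.denote (FaceCertKernel.ctx15 a b c0 c1 c2 c3 0 0 0 0 0 0 0 0 0 : Context ℝ) := by
    rw [← FaceCertKernel.denote_toPP _ _ (by decide +kernel)]
    exact FaceCertKernel.denote_nonneg_of_coeffsP _ hx _ (by decide +kernel)
  have hM : 0 < eMul4_3.denote (FaceCertKernel.ctx15 a b c0 c1 c2 c3 0 0 0 0 0 0 0 0 0 : Context ℝ) := by
    show (0:ℝ) < (2 + a)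
    positivity
  have hT : sahiE ν 3 ![setInd (U {0, 1}), setInd (U {0, 2, 3}), setInd (U {1, 2, 3})] = eT4_2.denote (FaceCertKernel.ctx15 a b c0 c1 c2 c3 0 0 0 0 0 0 0 0 0 : Context ℝ) := by
    subst ea eb e0 e1 e2 e3
    rw [sahiE_three]
    have x0 : ex ν (setInd (U {0, 1}) * setInd (U {0, 2, 3}) * setInd (U {1, 2, 3})) = ν out := by
      simp [ex_eq4, setInd_apply]
    have x1 : ex ν (setInd (U {0, 1})) = ν out + ν (pet 0) + ν (pet 1) := by
      simp [ex_eq4, setInd_apply]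
    have x2 : ex ν (setInd (U {0, 2, 3})) = ν out + ν (pet 0) + ν (pet 2) + ν (pet 3) := by
      simp [ex_eq4, setInd_apply]
    have x3 : ex ν (setInd (U {1, 2, 3})) = ν out + ν (pet 1) + ν (pet 2) + ν (pet 3) := by
      simp [ex_eq4, setInd_apply]
    have x4 : ex ν (setInd (U {0, 2, 3}) * setInd (U {1, 2, 3})) = ν out + ν (pet 2) + ν (pet 3) := by
      simp [ex_eq4, setInd_apply]
    have x5 : ex ν (setInd (U {0, 1}) * setInd (U {1, 2, 3})) = ν out + ν (pet 1) := by
      simp [ex_eq4, setInd_apply]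
    have x6 : ex ν (setInd (U {0, 1}) * setInd (U {0, 2, 3})) = ν out + ν (pet 0) := by
      simp [ex_eq4, setInd_apply]
    rw [x0, x1, x2, x3, x4, x5, x6]
    rfl
  have hR : sahiE ν 4 (fun i => setInd (U (Finset.univ.erase i))) = eR4.denote (FaceCertKernel.ctx15 a b c0 c1 c2 c3 0 0 0 0 0 0 0 0 0 : Context ℝ) := by
    subst ea eb e0 e1 e2 e3; exact row_eq4 ν
  rw [hR] at hrow
  rw [hT]
  exact (mul_nonneg_iff_of_pos_left hM).1 (by rw [hid]; exact add_nonneg hrow hP)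

set_option maxHeartbeats 2000000 in
set_option maxRecDepth 100000 in
/-- Co-singleton type 3 of `Sun 4` (index sets `[[0, 1, 3], [0, 2, 3], [1, 2, 3]]`): `E_3 ≥ 0` from the top row, by the kernel-checked domination identity
`(2 + a)·E_3 = E_4(row) + P`, `P ≥ 0` (cell masses abbreviated by `ea, eb, e_j`; instantiate with `rfl`). [this work] -/
theorem co4_3 {ν : Sun 4 → ℝ} (hν0 : ∀ x, 0 ≤ ν x) (hν1 : ∑ x, ν x = 1)
    (hrow : 0 ≤ sahiE ν 4 (fun i => setInd (U (Finset.univ.erase i))))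
    {a b c0 c1 c2 c3 : ℝ} (ea : ν core = a) (eb : ν out = b) (e0 : ν (pet 0) = c0) (e1 : ν (pet 1) = c1) (e2 : ν (pet 2) = c2) (e3 : ν (pet 3) = c3) :
    0 ≤ sahiE ν 3 ![setInd (U {0, 1, 3}), setInd (U {0, 2, 3}), setInd (U {1, 2, 3})] := by
  have ha : 0 ≤ a := ea ▸ hν0 core
  have hb : 0 ≤ b := eb ▸ hν0 out
  have h0 : 0 ≤ c0 := e0 ▸ hν0 (pet 0)
  have h1 : 0 ≤ c1 := e1 ▸ hν0 (pet 1)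
  have h2 : 0 ≤ c2 := e2 ▸ hν0 (pet 2)
  have h3 : 0 ≤ c3 := e3 ▸ hν0 (pet 3)
  have hx := FaceCertKernel.ctx15_get_nonneg (R := ℝ) ha hb h0 h1 h2 h3 (le_refl (0:ℝ)) (le_refl (0:ℝ)) (le_refl (0:ℝ)) (le_refl (0:ℝ)) (le_refl (0:ℝ)) (le_refl (0:ℝ)) (le_refl (0:ℝ)) (le_refl (0:ℝ)) (le_refl (0:ℝ))
  have htot : a + b + c0 + c1 + c2 + c3 = 1 := by subst ea eb e0 e1 e2 e3; exact sum_one_eq4 hν1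
  have hA : eA4.denote (FaceCertKernel.ctx15 a b c0 c1 c2 c3 0 0 0 0 0 0 0 0 0 : Context ℝ) = a := by
    show (1:ℝ) - (b + c0 + c1 + c2 + c3) = a
    linarith
  have hchk : FaceCertKernel.subCheckP (FaceCertKernel.toPP (SunCert.subst0 eA4 (.mul eMul4_3 eT4_3)))
      (FaceCertKernel.toPP (SunCert.subst0 eA4 (.add eR4 eP4_3))) = true := by
    decide +kernel
  have hid := FaceCertKernel.denote_eq_of_subCheckP (FaceCertKernel.ctx15 a b c0 c1 c2 c3 0 0 0 0 0 0 0 0 0 : Context ℝ) _ _ hchk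
  rw [FaceCertKernel.denote_toPP _ _ (by decide +kernel), FaceCertKernel.denote_toPP _ _ (by decide +kernel),
    SunCert.denote_subst0, SunCert.denote_subst0, hA, SunCert.denote_mul, SunCert.denote_add] at hid
  have hP : 0 ≤ eP4_3.denote (FaceCertKernel.ctx15 a b c0 c1 c2 c3 0 0 0 0 0 0 0 0 0 : Context ℝ) := by
    rw [← FaceCertKernel.denote_toPP _ _ (by decide +kernel)]
    exact FaceCertKernel.denote_nonneg_of_coeffsP _ hx _ (by decide +kernel)
  have hM : 0 < eMul4_3.denote (FaceCertKernel.ctx15 a b c0 c1 c2 c3 0 0 0 0 0 0 0 0 0 : Context ℝ) := by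
    show (0:ℝ) < (2 + a)
    positivity
  have hT : sahiE ν 3 ![setInd (U {0, 1, 3}), setInd (U {0, 2, 3}), setInd (U {1, 2, 3})] = eT4_3.denote (FaceCertKernel.ctx15 a b c0 c1 c2 c3 0 0 0 0 0 0 0 0 0 : Context ℝ) := by
    subst ea eb e0 e1 e2 e3
    rw [sahiE_three]
    have x0 : ex ν (setInd (U {0, 1, 3}) * setInd (U {0, 2, 3}) * setInd (U {1, 2, 3})) = ν out + ν (pet 3) := by
      simp [ex_eq4, setInd_apply]
    have x1 : ex ν (setInd (U {0, 1, 3})) = ν out + ν (pet 0) + ν (pet 1) + ν (pet 3) := by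
      simp [ex_eq4, setInd_apply]
    have x2 : ex ν (setInd (U {0, 2, 3})) = ν out + ν (pet 0) + ν (pet 2) + ν (pet 3) := by
      simp [ex_eq4, setInd_apply]
    have x3 : ex ν (setInd (U {1, 2, 3})) = ν out + ν (pet 1) + ν (pet 2) + ν (pet 3) := by
      simp [ex_eq4, setInd_apply]
    have x4 : ex ν (setInd (U {0, 2, 3}) * setInd (U {1, 2, 3})) = ν out + ν (pet 2) + ν (pet 3) := by
      simp [ex_eq4, setInd_apply]
    have x5 : ex ν (setInd (U {0, 1, 3}) * setInd (U {1, 2, 3})) = ν out + ν (pet 1) + ν (pet 3) := by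
      simp [ex_eq4, setInd_apply]
    have x6 : ex ν (setInd (U {0, 1, 3}) * setInd (U {0, 2, 3})) = ν out + ν (pet 0) + ν (pet 3) := by
      simp [ex_eq4, setInd_apply]
    rw [x0, x1, x2, x3, x4, x5, x6]
    rfl
  have hR : sahiE ν 4 (fun i => setInd (U (Finset.univ.erase i))) = eR4.denote (FaceCertKernel.ctx15 a b c0 c1 c2 c3 0 0 0 0 0 0 0 0 0 : Context ℝ) := by
    subst ea eb e0 e1 e2 e3; exact row_eq4 ν
  rw [hR] at hrow
  rw [hT]
  exact (mul_nonneg_iff_of_pos_left hM).1 (by rw [hid]; exact add_nonneg hrow hP)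

end Sun
end Summit.CriticalPhenomena.PercolationContinuityZ3.Theorems.SahiDeltaSystem
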